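import Mathlib.RingTheory.MvPolynomial.Homogeneous
import Mathlib.LinearAlgebra.Matrix.Determinant.Basic
import Summits.ValiantsHypothesis.ValiantsHypothesis.Theses.PrincipalMinorColouring
import Literature.Computability.AlgebraicComplexity.PrincipalMinorRepr
import Literature.Computability.AlgebraicComplexity.DeterminantalComplexityProofs

/-!
# Route `PrincipalMinorColouring`, support item `PMReprIsDetRepr` (stmt-ValiantsHypothesis-3780)

A principal-minor representation `per_n(x + J) = n! · det(1 + diag(x ∘ κ) · K)` of size `R` is an
affine determinantal representation of `per_n` of the same size `R`: absorb the constant `n!`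
into the first row (`HasPrincipalMinorRepr.hasDetRepr`, which needs `R ≥ 1`) and undo the shift by
the affine substitution `x ↦ x − J`, which keeps the entries affine
(`HasDetRepr.totalDegree_aeval_le_of_le_one`). In the degenerate size `R = 0` the hypothesis says
that `per_n(x + J)` is the constant `n!`, so `per_n` is a nonzero constant, hence `n = 0` by
homogeneity, and `per_0 = 1` is the empty determinant. Consequently `dc(per_n) ≤ pmc(per_n)`
(Mignon–Ressayre 2004, §1; Ikenmeyer–Landsberg 2017, Def. 2.8).
-/

set_option linter.dupNamespace false

noncomputable section

open MvPolynomial Matrix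
open Literature.Computability.AlgebraicComplexity

namespace Summit.ValiantsHypothesis.ValiantsHypothesis.Theorems

/-- Affine substitutions preserve affine determinantal representations: if `f = det A` with
affine entries and every `a i` has total degree `≤ 1`, then `aeval a f = det ((aeval a) ∘ A)` with
affine entries (Bürgisser 2000, §2.5; the proof of `HasDetRepr.of_isProjection_holds` verbatim,
for affine forms instead of variables and constants). [folklore] -/
theorem hasDetRepr_aeval_of_totalDegree_le_one {σ τ k : Type*} [CommRing k]
    {f : MvPolynomial σ k} {m : ℕ} (h : HasDetRepr f m) (a : σ → MvPolynomial τ k)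
    (ha : ∀ i, (a i).totalDegree ≤ 1) : HasDetRepr (aeval a f) m := by
  obtain ⟨A, hA, rfl⟩ := h
  refine ⟨(aeval a).mapMatrix A, fun i j => ?_, (AlgHom.map_det _ _).symm⟩
  rw [AlgHom.mapMatrix_apply, Matrix.map_apply]
  exact (HasDetRepr.totalDegree_aeval_le_of_le_one a ha _).trans (hA i j)

/-- Undoing the shift `x ↦ x + J`: substituting `x ↦ x − 1` after `x ↦ x + 1` is the identity.
[folklore] -/
theorem aeval_X_sub_one_aeval_X_add_one {σ k : Type*} [CommRing k] (p : MvPolynomial σ k) :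
    aeval (fun e => (X e - 1 : MvPolynomial σ k)) (aeval (fun e => (X e + 1 : MvPolynomial σ k)) p) =
      p := by
  rw [← AlgHom.comp_apply, comp_aeval]
  have hX : (fun i => aeval (fun e => (X e - 1 : MvPolynomial σ k)) (X i + 1 : MvPolynomial σ k)) =
      X := by
    funext i
    rw [map_add, map_one, aeval_X, sub_add_cancel]
  rw [hX, aeval_X_left, AlgHom.id_apply]

/-- The affine forms `x_e − 1` have total degree `≤ 1`. [folklore] -/
theorem totalDegree_X_sub_one_le {σ k : Type*} [CommRing k] (i : σ) :
    (X i - 1 : MvPolynomial σ k).totalDegree ≤ 1 := by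
  refine (totalDegree_sub _ _).trans (max_le ?_ ?_)
  · exact (isHomogeneous_X k i).totalDegree_le
  · rw [totalDegree_one]
    exact Nat.zero_le _

/-- **Item `PMReprIsDetRepr` (stmt-ValiantsHypothesis-3780), converse bookkeeping.** A
principal-minor representation `per_n(x+J) = n!·det(1 + diag(x∘κ)·K)` of size `R` yields an
affine determinantal representation of `per_n` of size `R` (substitute `x = y − J`, absorb `n!`
into one row; `R = 0` forces `n = 0`); hence `dc(per_n) ≤ pmc(per_n)`.
[cite: MignonRessayre2004, §1] [cite: IkenmeyerLandsberg2017, Def. 2.8] -/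
theorem pmReprIsDetRepr_proof :
    Summit.ValiantsHypothesis.ValiantsHypothesis.Theses.PrincipalMinorColouring.PMReprIsDetRepr := by
  unfold Summit.ValiantsHypothesis.ValiantsHypothesis.Theses.PrincipalMinorColouring.PMReprIsDetRepr
  intro n R K κ h
  cases R with
  | zero =>
    -- degenerate size: `per_n(x+J)` is the constant `n!`, so `per_n` is constant and `n = 0`
    have hg : aeval (fun e => (X e + 1 : MvPolynomial (Fin n × Fin n) ℂ)) (perPoly (Fin n) ℂ) =
        C (n.factorial : ℂ) := by
      rw [h, Matrix.det_isEmpty, mul_one]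
    have hper : perPoly (Fin n) ℂ = C (n.factorial : ℂ) := by
      rw [← aeval_X_sub_one_aeval_X_add_one (perPoly (Fin n) ℂ), hg, algHom_C, algebraMap_eq]
    have hn : Fintype.card (Fin n) = 0 := by
      refine (perPoly_isHomogeneous (n := Fin n) (k := ℂ)).inj_right ?_ ?_
      · rw [hper]
        exact isHomogeneous_C _ _
      · rw [hper, Ne, C_eq_zero, Nat.cast_eq_zero]
        exact Nat.factorial_ne_zero n
    rw [Fintype.card_fin] at hn
    subst hn
    refine ⟨1, fun i => Fin.elim0 i, ?_⟩
    rw [Matrix.det_isEmpty, hper, Nat.factorial_zero, Nat.cast_one, C_1]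
  | succ R =>
    -- `R + 1 ≥ 1`: absorb `n!` into a row, then undo the shift
    have hpm : HasPrincipalMinorRepr
        (aeval (fun e => (X e + 1 : MvPolynomial (Fin n × Fin n) ℂ)) (perPoly (Fin n) ℂ)) (R + 1) :=
      ⟨(n.factorial : ℂ), K, κ, h⟩
    have hdet := hasDetRepr_aeval_of_totalDegree_le_one (hpm.hasDetRepr (Nat.le_add_left 1 R))
      (fun e => (X e - 1 : MvPolynomial (Fin n × Fin n) ℂ)) totalDegree_X_sub_one_le
    rwa [aeval_X_sub_one_aeval_X_add_one] at hdet

end Summit.ValiantsHypothesis.ValiantsHypothesis.Theorems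

end
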